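import Summits.Langlands.Langlands.Theorems.CliffordTateStructureKroneckerHom
import Literature.NumberTheory.GaloisRepresentations.CliffordConstituentGeometric
import Literature.NumberTheory.GaloisRepresentations.ArtinRestriction
import Literature.NumberTheory.GaloisRepresentations.OrdinaryGaloisRep
import Literature.NumberTheory.PAdicHodge.DeRhamBaseChangeProofs
import Literature.NumberTheory.PAdicHodge.DeRhamRestrictFieldDescentHolds
import HarnessLib

/-!
# Clifford–Tate structure: geometricity of the Kronecker factors

If `Q ρ Q⁻¹ = e·(ρ₁ ⊗ ρ₂)·e⁻¹` with `ρ` unramified almost everywhere and de Rham at `ℓ` and `ρ₂`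
of FINITE image, then both factors are unramified almost everywhere and de Rham at `ℓ`:

* `ρ₂`: finite image ⇒ open kernel ⇒ unramified a.e. (`eventually_isUnramifiedAt_of_isOpen_ker`),
  and finite-image local representations are de Rham
  (`fontainePstAdicCompletion_isDeRhamFramed_of_finite_range`);
* `ρ₁`: at a place where `ρ` and `ρ₂` are unramified, `ρ₁(σ) ⊗ 1 = 1` on inertia, so `ρ₁(σ) = 1`
  (`kronecker_left_cancel`); over the number field `L = K̄^{ker ρ₂}` one has
  `(QρQ⁻¹)|_{Γ_L} = e·(ρ₁|_{Γ_L} ⊗ 1_d)·e⁻¹`, which is block upper triangular (indeed block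
  diagonal) with corner `ρ₁|_{Γ_L}` (`exists_fromBlocks_of_eq_reindex_kronecker_one`), so
  `ρ₁|_{Γ_L}` is de Rham at every `w ∣ ℓ` (`PstWeilDeligneData.isDeRhamFramed_blocks`,
  `DeRhamBaseChange_holds`) and `ρ₁` is de Rham at every `v ∣ ℓ` by descent
  (`DeRhamRestrictFieldDescent_holds`, Brinon–Conrad Prop. 6.3.8).
[cite: SerreAbelianLadic1968, Ch. I §2.1] [cite: FontaineAsterisque223III, Exp. III Prop. 1.5.2]
[cite: BrinonConrad2009, Prop. 6.3.8]
-/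

set_option autoImplicit false
set_option linter.dupNamespace false

noncomputable section

namespace Summit.Langlands.Langlands.Theorems

open Filter NumberField IsDedekindDomain Field Matrix
open Literature.NumberTheory.Automorphic Literature.NumberTheory.GaloisRepresentations
open Literature.NumberTheory.PAdicHodge
open scoped Kronecker MatrixGroups

/-! ### §1 `R ⊗ 1_d` is block upper triangular with corner `R` -/

section Blocks

variable {G : Type*} [Group G] [TopologicalSpace G] [IsTopologicalGroup G]
  {A : Type*} [CommRing A] [TopologicalSpace A] {a d n : ℕ}

/-- **`e·(R ⊗ 1_d)·e⁻¹` is block upper triangular with corner `R`.** [folklore] -/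
theorem exists_fromBlocks_of_eq_reindex_kronecker_one (hd : 0 < d) (T : FramedRep G A n)
    (R : FramedRep G A a) (e : Fin a × Fin d ≃ Fin n)
    (hT : ∀ g, ((T g : GL (Fin n) A) : Matrix (Fin n) (Fin n) A) =
      Matrix.reindex e e (((R g : GL (Fin a) A) : Matrix (Fin a) (Fin a) A) ⊗ₖ
        (1 : Matrix (Fin d) (Fin d) A))) :
    ∃ (q : ℕ) (E : Fin a ⊕ Fin q ≃ Fin n) (D : FramedRep G A q),
      ∀ g, ∃ B : Matrix (Fin a) (Fin q) A,
        ((T g : GL (Fin n) A) : Matrix (Fin n) (Fin n) A) =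
          Matrix.reindex E E (Matrix.fromBlocks ((R g : GL (Fin a) A) : Matrix (Fin a) (Fin a) A)
            B 0 ((D g : GL (Fin q) A) : Matrix (Fin q) (Fin q) A)) := by
  classical
  let l₀ : Fin d := ⟨0, hd⟩
  let q : ℕ := Fintype.card ({l : Fin d // l ≠ l₀} × Fin a)
  let e' : ({l : Fin d // l ≠ l₀} × Fin a) ≃ Fin q := Fintype.equivFin _
  obtain ⟨E₁, hE₁l, hE₁r⟩ := exists_blockSplitEquiv l₀ (Fin a)
  let E₀ : Fin a ⊕ Fin q ≃ Fin a × Fin d :=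
    (Equiv.sumCongr (Equiv.refl (Fin a)) e'.symm).trans (E₁.trans (Equiv.prodComm (Fin d) (Fin a)))
  let E : Fin a ⊕ Fin q ≃ Fin n := E₀.trans e
  have hentry : ∀ (g : G) (x y : Fin a ⊕ Fin q),
      ((T g : GL (Fin n) A) : Matrix (Fin n) (Fin n) A) (E x) (E y) =
        ((R g : GL (Fin a) A) : Matrix (Fin a) (Fin a) A) (E₀ x).1 (E₀ y).1 *
          (1 : Matrix (Fin d) (Fin d) A) (E₀ x).2 (E₀ y).2 := by
    intro g x y
    rw [hT]
    simp only [E, Matrix.reindex_apply, Matrix.submatrix_apply, Equiv.trans_apply,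
      Equiv.symm_apply_apply, Matrix.kroneckerMap_apply]
  have hl : ∀ b : Fin a, E₀ (Sum.inl b) = (b, l₀) := by
    intro b; simp [E₀, hE₁l]
  have hr : ∀ c : Fin q, (E₀ (Sum.inr c)).2 ≠ l₀ := by
    intro c; simpa [E₀, hE₁r] using (e'.symm c).1.2
  have h21 : ∀ g, Matrix.toBlocks₂₁
      (((T g : GL (Fin n) A) : Matrix (Fin n) (Fin n) A).submatrix E E) = 0 := by
    intro g
    ext c b
    simp only [Matrix.toBlocks₂₁, Matrix.of_apply, Matrix.submatrix_apply, Matrix.zero_apply]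
    rw [hentry, hl, Matrix.one_apply_ne (hr c), mul_zero]
  have h11 : ∀ g, Matrix.toBlocks₁₁
      (((T g : GL (Fin n) A) : Matrix (Fin n) (Fin n) A).submatrix E E) =
        ((R g : GL (Fin a) A) : Matrix (Fin a) (Fin a) A) := by
    intro g
    ext y x
    simp only [Matrix.toBlocks₁₁, Matrix.of_apply, Matrix.submatrix_apply]
    rw [hentry, hl, hl, Matrix.one_apply_eq, mul_one]
  obtain ⟨D, hD⟩ := FramedRep.exists_eq_reindex_fromBlocks T E h21
  refine ⟨q, E, D, fun g =>
    ⟨Matrix.toBlocks₁₂ (((T g : GL (Fin n) A) : Matrix (Fin n) (Fin n) A).submatrix E E), ?_⟩⟩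
  have h := hD g
  rwa [h11 g] at h

end Blocks

/-! ### §2 A finite-image factor is geometric -/

section Finite

variable (K : Type) [Field K] [NumberField K] {ℓ : ℕ} [Fact ℓ.Prime] {d : ℕ}

omit [NumberField K] in
/-- The range subgroup of a finite-image representation is finite. [folklore] -/
theorem finite_range_toMonoidHom_of_finite (ρ₂ : FramedGaloisRep K (PadicAlgCl ℓ) d)
    (hfin : (Set.range (fun g : absoluteGaloisGroup K => (ρ₂ g : GL (Fin d) (PadicAlgCl ℓ)))).Finite) :
    Finite ρ₂.toMonoidHom.range := by
  have h4 : (ρ₂.toMonoidHom.range : Set (GL (Fin d) (PadicAlgCl ℓ))) =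
      Set.range (fun g : absoluteGaloisGroup K => (ρ₂ g : GL (Fin d) (PadicAlgCl ℓ))) := by
    rw [MonoidHom.coe_range]; rfl
  exact Set.finite_coe_iff.mpr (h4 ▸ hfin)

/-- **A finite-image `ℓ`-adic Galois representation is unramified almost everywhere and de Rham
at `ℓ`.** [cite: SerreAbelianLadic1968, Ch. I §2.1] [cite: FontaineAsterisque223III, Exp. III §1.5] -/
theorem isUnramifiedAt_and_isDeRhamFramed_of_finite_range (ρ₂ : FramedGaloisRep K (PadicAlgCl ℓ) d)
    (hfin : (Set.range (fun g : absoluteGaloisGroup K => (ρ₂ g : GL (Fin d) (PadicAlgCl ℓ)))).Finite) :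
    (∀ᶠ v : HeightOneSpectrum (𝓞 K) in cofinite, ρ₂.IsUnramifiedAt v) ∧
      ∀ (v : HeightOneSpectrum (𝓞 K)) (hv : ((ℓ : ℕ) : 𝓞 K) ∈ v.asIdeal),
        (fontainePstAdicCompletion v ℓ hv).IsDeRhamFramed (ρ₂.toLocal v) := by
  haveI : Finite ρ₂.toMonoidHom.range := finite_range_toMonoidHom_of_finite K ρ₂ hfin
  refine ⟨FramedGaloisRep.eventually_isUnramifiedAt_of_isOpen_ker ρ₂ (isOpen_ker_of_finite_range ρ₂),
    fun v hv => fontainePstAdicCompletion_isDeRhamFramed_of_finite_range v ℓ hv (ρ₂.toLocal v) ?_⟩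
  refine hfin.subset ?_
  rintro _ ⟨σ, rfl⟩
  exact ⟨absGaloisRestrict K (v.adicCompletion K) σ, rfl⟩

end Finite

/-! ### §3 The complementary factor is geometric -/

section Left

variable (K : Type) [Field K] [NumberField K] {ℓ : ℕ} [Fact ℓ.Prime] {n a d : ℕ}

set_option maxHeartbeats 800000 in
set_option backward.isDefEq.respectTransparency false in
/-- **The complementary Kronecker factor of a geometric representation is geometric** (given that
the other factor has finite image). [cite: SerreAbelianLadic1968, Ch. I §2.1]
[cite: FontaineAsterisque223III, Exp. III Prop. 1.5.2] [cite: BrinonConrad2009, Prop. 6.3.8] -/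
theorem isUnramifiedAt_and_isDeRhamFramed_leftFactor (hd : 0 < d)
    (ρ : FramedGaloisRep K (PadicAlgCl ℓ) n) (ρ₁ : FramedGaloisRep K (PadicAlgCl ℓ) a)
    (ρ₂ : FramedGaloisRep K (PadicAlgCl ℓ) d) (Q : GL (Fin n) (PadicAlgCl ℓ))
    (e : Fin a × Fin d ≃ Fin n)
    (hconj : ∀ g : absoluteGaloisGroup K,
      ((FramedRep.conj Q ρ g : GL (Fin n) (PadicAlgCl ℓ)) : Matrix (Fin n) (Fin n) (PadicAlgCl ℓ)) =
        Matrix.reindex e e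
          (((ρ₁ g : GL (Fin a) (PadicAlgCl ℓ)) : Matrix (Fin a) (Fin a) (PadicAlgCl ℓ)) ⊗ₖ
            ((ρ₂ g : GL (Fin d) (PadicAlgCl ℓ)) : Matrix (Fin d) (Fin d) (PadicAlgCl ℓ))))
    (hfin : (Set.range (fun g : absoluteGaloisGroup K => (ρ₂ g : GL (Fin d) (PadicAlgCl ℓ)))).Finite)
    (hunr : ∀ᶠ v : HeightOneSpectrum (𝓞 K) in cofinite, ρ.IsUnramifiedAt v)
    (hdR : ∀ (v : HeightOneSpectrum (𝓞 K)) (hv : ((ℓ : ℕ) : 𝓞 K) ∈ v.asIdeal),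
      (fontainePstAdicCompletion v ℓ hv).IsDeRhamFramed (ρ.toLocal v)) :
    (∀ᶠ v : HeightOneSpectrum (𝓞 K) in cofinite, ρ₁.IsUnramifiedAt v) ∧
      ∀ (v : HeightOneSpectrum (𝓞 K)) (hv : ((ℓ : ℕ) : 𝓞 K) ∈ v.asIdeal),
        (fontainePstAdicCompletion v ℓ hv).IsDeRhamFramed (ρ₁.toLocal v) := by
  classical
  haveI : Nonempty (Fin d) := ⟨⟨0, hd⟩⟩
  refine ⟨?_, fun v hv => ?_⟩
  · -- unramified almost everywhere
    have h2 := (isUnramifiedAt_and_isDeRhamFramed_of_finite_range K ρ₂ hfin).1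
    refine (hunr.and h2).mono fun v hv => ?_
    obtain ⟨hv1, hv2⟩ := hv
    intro 𝔓 h𝔓 σ hσ
    have hρ : ρ σ = 1 := hv1 𝔓 h𝔓 σ hσ
    have hρ2 : ρ₂ σ = 1 := hv2 𝔓 h𝔓 σ hσ
    have h3 := hconj σ
    rw [FramedRep.conj_apply, hρ, mul_one, mul_inv_cancel, hρ2, Units.val_one, Units.val_one]
      at h3
    have h4 : Matrix.reindex e e
        ((((ρ₁ σ : GL (Fin a) (PadicAlgCl ℓ)) : Matrix (Fin a) (Fin a) (PadicAlgCl ℓ))) ⊗ₖ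
          (1 : Matrix (Fin d) (Fin d) (PadicAlgCl ℓ))) =
        Matrix.reindex e e ((1 : Matrix (Fin a) (Fin a) (PadicAlgCl ℓ)) ⊗ₖ
          (1 : Matrix (Fin d) (Fin d) (PadicAlgCl ℓ))) := by
      rw [← h3, Matrix.one_kronecker_one, Matrix.reindex_apply, Matrix.submatrix_one_equiv]
    have h5 := kronecker_left_cancel ((Matrix.reindex e e).injective h4) one_ne_zero
    exact Units.val_eq_one.1 h5
  · -- de Rham at `v ∣ ℓ`: pass to `L = K̄^{ker ρ₂}` and descend
    haveI : Finite ρ₂.toMonoidHom.range := finite_range_toMonoidHom_of_finite K ρ₂ hfin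
    set N₂ : Subgroup (absoluteGaloisGroup K) := ρ₂.toMonoidHom.ker with hN₂
    have hker : IsOpen (N₂ : Set (absoluteGaloisGroup K)) := isOpen_ker_of_finite_range ρ₂
    let L : IntermediateField K (AlgebraicClosure K) := IntermediateField.fixedField N₂
    haveI : FiniteDimensional K L := finiteDimensional_fixedField_of_isOpen N₂ hker
    haveI : NumberField L := NumberField.of_module_finite K L
    obtain ⟨g, hg⟩ := exists_mem_range_absGaloisRestrict_fixedField_iff N₂ hker
    have hres : ∀ σ : absoluteGaloisGroup L, ρ₂ (absGaloisRestrict K L σ) = 1 := by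
      intro σ
      have h2 := (hg (absGaloisRestrict K L σ)).1 ⟨σ, rfl⟩
      have h3 := Subgroup.Normal.conj_mem (inferInstance : N₂.Normal) _ h2 g
      rw [show g * (g⁻¹ * absGaloisRestrict K L σ * g) * g⁻¹ = absGaloisRestrict K L σ by group]
        at h3
      exact (MonoidHom.mem_ker).1 h3
    -- the block form over `Γ_L`
    have hT : ∀ σ : absoluteGaloisGroup L,
        ((FramedGaloisRep.restrictField L (FramedRep.conj Q ρ) σ : GL (Fin n) (PadicAlgCl ℓ)) :
          Matrix (Fin n) (Fin n) (PadicAlgCl ℓ)) =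
          Matrix.reindex e e ((((ρ₁.restrictField L) σ : GL (Fin a) (PadicAlgCl ℓ)) :
            Matrix (Fin a) (Fin a) (PadicAlgCl ℓ)) ⊗ₖ (1 : Matrix (Fin d) (Fin d) (PadicAlgCl ℓ))) := by
      intro σ
      rw [FramedGaloisRep.restrictField_apply, FramedGaloisRep.restrictField_apply, hconj, hres σ,
        Units.val_one]
    obtain ⟨q, E, D, hblock⟩ := exists_fromBlocks_of_eq_reindex_kronecker_one hd
      (FramedGaloisRep.restrictField L (FramedRep.conj Q ρ)) (ρ₁.restrictField L) e hT
    -- `ρ₁|_{Γ_L}` is de Rham at every `w ∣ ℓ`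
    have hL : ∀ (w : HeightOneSpectrum (𝓞 L)) (hw : ((ℓ : ℕ) : 𝓞 L) ∈ w.asIdeal),
        (fontainePstAdicCompletion w ℓ hw).IsDeRhamFramed ((ρ₁.restrictField L).toLocal w) := by
      intro w hw
      have hRdR : (fontainePstAdicCompletion w ℓ hw).IsDeRhamFramed
          ((FramedGaloisRep.restrictField L (FramedRep.conj Q ρ)).toLocal w) := by
        refine isDeRhamFramed_toLocal_restrictField DeRhamBaseChange_holds (FramedRep.conj Q ρ)
          (fun v hv => ?_) w hw
        rw [FramedGaloisRep.toLocal_conj, PstWeilDeligneData.isDeRhamFramed_conj_iff]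
        exact hdR v hv
      have hT' : ∀ g : absoluteGaloisGroup (w.adicCompletion L),
          ∃ B : Matrix (Fin a) (Fin q) (PadicAlgCl ℓ),
            (((FramedGaloisRep.restrictField L (FramedRep.conj Q ρ)).toLocal w g :
                GL (Fin n) (PadicAlgCl ℓ)) : Matrix (Fin n) (Fin n) (PadicAlgCl ℓ)) =
              Matrix.reindex E E (Matrix.fromBlocks
                (((ρ₁.restrictField L).toLocal w g : GL (Fin a) (PadicAlgCl ℓ)) :
                  Matrix (Fin a) (Fin a) (PadicAlgCl ℓ)) B 0
                ((FramedGaloisRep.toLocal w D g : GL (Fin q) (PadicAlgCl ℓ)) :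
                  Matrix (Fin q) (Fin q) (PadicAlgCl ℓ))) :=
        fun g => hblock _
      exact ((fontainePstAdicCompletion w ℓ hw).isDeRhamFramed_blocks E hT' hRdR).1
    exact DeRhamRestrictFieldDescent_holds K L ℓ a ρ₁ hL v hv

end Left

end Summit.Langlands.Langlands.Theorems

end
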